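import Literature.Geometry.Lorentzian.ModelData
import Literature.Geometry.Lorentzian.HypersurfaceRestriction
import Mathlib.Geometry.Manifold.Instances.Sphere
import HarnessLib

/-!
# The minimal throat of the time-symmetric Schwarzschild data is an immersed sphere (discharge of `Schwarzschild.isSpacelikeImmersion_throatEmbed`)

Discharge of the named fact `Schwarzschild.isSpacelikeImmersion_throatEmbed` (`ModelData.lean`):
for `M > 0` the throat embedding `ω ↦ (M/2) ω` of the unit sphere `S² = Metric.sphere (0 : E3) 1`
(with Mathlib's analytic manifold structure, `EuclideanSpace.instIsManifoldSphere`) onto the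
coordinate sphere `‖y‖ = M/2` of the punctured slice `(E3 ∖ {0}, ψ⁴ δ)` is a spacelike (that is,
Riemannian) immersion for the time-symmetric Schwarzschild data `Schwarzschild.timeSymmetricData`:
it is `C^∞` and the induced form `h(dι v, dι v)` is positive for `v ≠ 0`. This is the hypothesis
`hf` of the MOTS statement `Schwarzschild.isMOTSInData_throat`. MTW 1973, §31.7 (the throat
`r̄ = M/2` of the isotropic slice); O'Neill 1983, Ch. 4, p. 97 (immersed submanifolds,
`(f^* g)(v, v) > 0`).

## Proof

Exactly as for the round sphere (`Literature.Geometry.Riemannian.isSpacelikeImmersion_coe_sphere`,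
`RoundSphere.lean`): the inclusion `ι : S² → E3` is smooth (Mathlib `contMDiff_coe_sphere`) with
injective differential (Mathlib `mfderiv_coe_sphere_injective`); the throat embedding is the
dilation `(M/2) ι` with values in the open subset `puncturedSlice ⊆ E3`, so it is smooth as a map
into the open submanifold (`ChartedSpace.liftPropWithinAt_subtypeVal_comp_iff`) with differential
`(M/2) dι` (`hasMFDerivAt_subtypeVal`: the inclusion of an open submanifold has identity
differential), which is injective for `M ≠ 0`; and the data metric `h = ψ⁴ δ` is Riemannian, so
`h(dι' v, dι' v) > 0` whenever `dι' v ≠ 0`.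

* `Schwarzschild.contMDiff_throatEmbed` — the throat embedding is `C^m` for every `m`;
* `Schwarzschild.mfderiv_throatEmbed` — its differential is `(M/2) dι`;
* `Schwarzschild.isSpacelikeImmersion_throatEmbed_holds` — **the named fact, verbatim**.

Everything is proved; no definitions, no named facts.

## References

* C. W. Misner, K. S. Thorne, J. A. Wheeler, *Gravitation*, Freeman 1973, §31.7.
* B. O'Neill, *Semi-Riemannian geometry with applications to relativity*, Academic Press 1983,
  Ch. 4, p. 97.
* H. L. Bray, *Proof of the Riemannian Penrose inequality using the positive mass theorem*,
  J. Differential Geom. 59 (2001), §1.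
-/

noncomputable section

open Set Function Bundle TopologicalSpace Manifold Metric Module
open scoped ContDiff Manifold Topology

namespace Literature.Geometry.Lorentzian

namespace Schwarzschild

/-- The model dimension count of the unit sphere of `E3`: `dim E3 = 2 + 1` (Mathlib
`finrank_euclideanSpace_fin`), the instance hypothesis of Mathlib's sphere charts. [folklore] -/
private theorem fact_finrank_E3 : Fact (finrank ℝ E3 = 2 + 1) := ⟨finrank_euclideanSpace_fin⟩

/-- **The throat embedding is smooth** (`C^m` for every `m`): it is the dilation `ω ↦ (M/2) ω` of
Mathlib's analytic inclusion `S² ↪ E3` (`contMDiff_coe_sphere`), read in the open submanifold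
`puncturedSlice` (`ChartedSpace.liftPropWithinAt_subtypeVal_comp_iff`). MTW 1973, §31.7.
[cite: MTW1973, §31.7] -/
theorem contMDiff_throatEmbed (M : ℝ) (hM : 0 < M) (m : ℕ∞ω) :
    ContMDiff (𝓡 2) 𝓘(ℝ, E3) m (throatEmbed M hM) := by
  haveI := fact_finrank_E3
  have hc : ContMDiff (𝓡 2) 𝓘(ℝ, ℝ) m (fun _ : sphere (0 : E3) 1 ↦ (M / 2 : ℝ)) := contMDiff_const
  have hι : ContMDiff (𝓡 2) 𝓘(ℝ, E3) m (Subtype.val : sphere (0 : E3) 1 → E3) := contMDiff_coe_sphere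
  have hg : ContMDiff (𝓡 2) 𝓘(ℝ, E3) m (fun p : sphere (0 : E3) 1 ↦ (M / 2 : ℝ) • (p : E3)) :=
    hc.smul hι
  exact fun y ↦ (ChartedSpace.liftPropWithinAt_subtypeVal_comp_iff (throatEmbed M hM) univ y).mp (hg y)

/-- **The differential of the throat embedding is `(M/2) dι`**, `ι : S² ↪ E3` the inclusion: the
inclusion of the open submanifold `puncturedSlice ⊆ E3` has identity differential
(`hasMFDerivAt_subtypeVal`), and `d((M/2) ι) = (M/2) dι`. MTW 1973, §31.7. [cite: MTW1973, §31.7] -/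
theorem mfderiv_throatEmbed (M : ℝ) (hM : 0 < M) (y : sphere (0 : E3) 1) :
    mfderiv (𝓡 2) 𝓘(ℝ, E3) (throatEmbed M hM) y =
      (M / 2 : ℝ) • mfderiv (𝓡 2) 𝓘(ℝ, E3) (Subtype.val : sphere (0 : E3) 1 → E3) y := by
  haveI := fact_finrank_E3
  have hf : MDifferentiableAt (𝓡 2) 𝓘(ℝ, E3) (throatEmbed M hM) y :=
    (contMDiff_throatEmbed M hM 1 y).mdifferentiableAt one_ne_zero
  have h1 : HasMFDerivAt (𝓡 2) 𝓘(ℝ, E3) (Subtype.val ∘ throatEmbed M hM) y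
      ((ContinuousLinearMap.id ℝ E3).comp (mfderiv (𝓡 2) 𝓘(ℝ, E3) (throatEmbed M hM) y)) :=
    (hasMFDerivAt_subtypeVal (I' := 𝓘(ℝ, E3)) (throatEmbed M hM y)).comp y hf.hasMFDerivAt
  have h2 : HasMFDerivAt (𝓡 2) 𝓘(ℝ, E3) (Subtype.val ∘ throatEmbed M hM) y
      ((M / 2 : ℝ) • mfderiv (𝓡 2) 𝓘(ℝ, E3) (Subtype.val : sphere (0 : E3) 1 → E3) y) :=
    ((contMDiff_coe_sphere (m := 1) y).mdifferentiableAt one_ne_zero).hasMFDerivAt.const_smul (M / 2)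
  have h := h1.mfderiv.symm.trans h2.mfderiv
  rwa [ContinuousLinearMap.id_comp] at h

/-- **Discharge of the named fact `Schwarzschild.isSpacelikeImmersion_throatEmbed`**
(`ModelData.lean`), verbatim: for `M > 0` the throat embedding `ω ↦ (M/2) ω` of the unit sphere
into the time-symmetric Schwarzschild data `(E3 ∖ {0}, ψ⁴ δ, 0)` is a spacelike immersion — smooth
(`contMDiff_throatEmbed`), with `h(dι' v, dι' v) > 0` for `v ≠ 0` since `dι' = (M/2) dι` is
injective (Mathlib `mfderiv_coe_sphere_injective`) and `h = ψ⁴ δ` is Riemannian. MTW 1973, §31.7;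
O'Neill 1983, Ch. 4, p. 97. [cite: MTW1973, §31.7] -/
theorem isSpacelikeImmersion_throatEmbed_holds : ∀ M : ℝ, isSpacelikeImmersion_throatEmbed M := by
  intro M hM
  haveI := fact_finrank_E3
  refine ⟨contMDiff_throatEmbed M hM _, fun y v hv ↦ ?_⟩
  rw [PseudoRiemannianMetric.inducedBilin_apply, mfderiv_throatEmbed M hM y]
  have hne : mfderiv (𝓡 2) 𝓘(ℝ, E3) (Subtype.val : sphere (0 : E3) 1 → E3) y v ≠ 0 := fun h ↦
    hv (mfderiv_coe_sphere_injective y (by rw [h, map_zero]))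
  have hne' : ((M / 2 : ℝ) • mfderiv (𝓡 2) 𝓘(ℝ, E3) (Subtype.val : sphere (0 : E3) 1 → E3) y) v ≠ 0 := by
    change (M / 2 : ℝ) • mfderiv (𝓡 2) 𝓘(ℝ, E3) (Subtype.val : sphere (0 : E3) 1 → E3) y v ≠ 0
    exact smul_ne_zero (by positivity) hne
  exact (timeSymmetricData M hM.le).h.pos _ _ hne'

end Schwarzschild

end Literature.Geometry.Lorentzian

end
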